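import Summits.HodgeConjecture.CorCM.IrreducibleOddWeightsCommutantBases
import HarnessLib

/-!
# Density over the commutant, VIII: THE DOUBLE COMMUTANT THEOREM — an endomorphism preserving the stable irreducible
# `A` is the restriction of an element of `span(T)` IFF it commutes with the commutant on `A`; `ℬ|_A = span(T)|_A`,
# `dim 𝒟|_A · dim ℬ|_A = (dim A)²`; Burnside; `span(T)|_A` depends on `T` only through `𝒟`

COR-CM (cell `pub-hodgecm2`, binder seat `b16` gen 73, count-neutral claim THE BICOMMUTANT AND HODGE DOMINATION,
file K2 — pure linear algebra; theorems only, no definition, no named fact, no `sorry`).  NEW as organised here, hence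
under `Summits/`.  HONEST FRAMING: the von Neumann ∕ Jacobson DOUBLE COMMUTANT (bicommutant) theorem for ONE simple
module in the lane's unbundled shape (file C1: one ℚ-space `V`, operators `T_i` closed under composition with
identity, a stable IRREDUCIBLE finite-dimensional `A ≤ V`, the commutant `𝒟` a PARAMETER with its characterising
hypothesis), derived from file C3's density theorem through the D-bases of file K1.  THE BICOMMUTANT IS A PARAMETER
TOO: a subspace `ℬ ≤ End_ℚ(V)` with `hℬ : ψ ∈ ℬ ↔ (ψ(A) ⊆ A ∧ ψ L = L ψ on A for all L ∈ 𝒟)` — literally file C1's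
commutant of the family `(L)_{L ∈ 𝒟}`, so `exists_commutant` shows it is inhabited and C1's closure properties apply
to it verbatim.  `HC_CM` is neither used nor asserted; nothing here mentions CM fields.

* §1 `span(T) ≤ ℬ` (`mem_bicommutant_of_mem_span_range`); the bicommutant exists (`exists_bicommutant`).
* §2 **THE DOUBLE COMMUTANT THEOREM** (`exists_mem_span_range_eqOn_of_comm`): `ψ(A) ⊆ A` and `ψ L = L ψ` on `A` for
  every `L ∈ 𝒟` ⟹ **`ψ = φ` on `A` for some `φ ∈ span(T)`** — density on a D-basis `b` (K1) gives `φ` with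
  `φ b_k = ψ b_k`, and both commute with the D-coefficients of `a = Σ_k L_k b_k`; with its converse,
  `exists_mem_span_range_eqOn_iff`.  Hence **`ℬ|_A = span(T)|_A`** (`map_domRestrict'_bicommutant_eq`:
  `ℬ.map (domRestrict' A) = (span T).map (domRestrict' A)`), **`dim ℬ|_A · δ = (dim A)²`** and
  **`dim 𝒟|_A · dim ℬ|_A = (dim A)²`** (`finrank_commutant_mul_finrank_bicommutant_eq`, K1's counts).
* §3 **BURNSIDE** (`exists_mem_span_range_eqOn_of_scalar`): scalar commutant ⟹ EVERY `ψ` with `ψ(A) ⊆ A` is a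
  restriction of `span(T)`; `iff` form `forall_mem_map_domRestrict'_span_iff_finrank_eq_one` (every `f : A → V` with
  values in `A` restricts from `span(T)` IFF `δ = 1`; `δ = 1` ⟹ scalar commutant,
  `exists_eq_smul_of_finrank_map_applyₗ_eq_one`).  **TRIPLE COMMUTANT** (`mem_commutant_iff_forall_bicommutant`): `𝒟` is the commutant of
  `ℬ` on `A`.  **`span(T)|_A` DEPENDS ON `T` ONLY THROUGH `𝒟`** (`map_domRestrict'_span_eq_of_commutant_eq`): two
  operator families for which `A` is stable irreducible with the same commutant on `A` restrict to the same subspace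
  of `Hom_ℚ(A, V)`.

## References

* [Lang2002] S. Lang, *Algebra*, 3rd ed., XVII §3 Thm. 3.2 (density), Cor. 3.3 (Burnside), Cor. 3.5; XVII §1
  Prop. 1.1.
* [CurtisReiner1962] C. W. Curtis, I. Reiner, *Representation Theory of Finite Groups and Associative Algebras*,
  §27 (27.4) (Burnside), (27.8) (density); §59 (double centralizer property of simple modules).
* [Serre1977] J.-P. Serre, *Linear Representations of Finite Groups*, GTM 42, §6.2 Prop. 2 remark (the image of
  `ℂ[G]` in `End W_i` is all of `End W_i`).
-/

set_option autoImplicit false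

noncomputable section

open scoped BigOperators Classical

universe u v w w'

namespace Summit.HodgeConjecture.CorCM.IrrOdd

variable {V : Type v} [AddCommGroup V] [Module ℚ V] {ι : Type w} (T : ι → V →ₗ[ℚ] V)

/-! ### §1 The bicommutant contains the operators -/

omit [AddCommGroup V] [Module ℚ V] in
/-- **THE BICOMMUTANT EXISTS** — it is the commutant (file C1) of the family `(L)_{L ∈ 𝒟}`.
[cite: CurtisReiner1962, §59] -/
theorem exists_bicommutant [AddCommGroup V] [Module ℚ V] (𝒟 : Submodule ℚ (V →ₗ[ℚ] V)) (A : Submodule ℚ V) :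
    ∃ ℬ : Submodule ℚ (V →ₗ[ℚ] V), ∀ ψ : V →ₗ[ℚ] V,
      ψ ∈ ℬ ↔ (∀ a ∈ A, ψ a ∈ A) ∧
        ∀ (L : ↥𝒟) (a : V), a ∈ A → ψ ((L : V →ₗ[ℚ] V) a) = (L : V →ₗ[ℚ] V) (ψ a) :=
  exists_commutant (fun L : ↥𝒟 => (L : V →ₗ[ℚ] V)) A

/-- **`span(T) ≤ ℬ`**: an element of the span of the operators preserves `A` and commutes with the commutant on
`A` (file C1). [cite: Lang2002, XVII §3] [cite: CurtisReiner1962, §59] -/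
theorem mem_bicommutant_of_mem_span_range {𝒟 ℬ : Submodule ℚ (V →ₗ[ℚ] V)} {A : Submodule ℚ V}
    (h𝒟 : ∀ L : V →ₗ[ℚ] V, L ∈ 𝒟 ↔ (∀ a ∈ A, L a ∈ A) ∧ ∀ (i : ι) (a : V), a ∈ A → L (T i a) = T i (L a))
    (hℬ : ∀ ψ : V →ₗ[ℚ] V, ψ ∈ ℬ ↔ (∀ a ∈ A, ψ a ∈ A) ∧
      ∀ (L : ↥𝒟) (a : V), a ∈ A → ψ ((L : V →ₗ[ℚ] V) a) = (L : V →ₗ[ℚ] V) (ψ a))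
    (hAst : ∀ (i : ι) (v : V), v ∈ A → T i v ∈ A)
    {φ : V →ₗ[ℚ] V} (hφ : φ ∈ Submodule.span ℚ (Set.range T)) : φ ∈ ℬ :=
  (hℬ φ).2 ⟨fun _ ha => apply_mem_of_mem_span_range T hAst hφ ha,
    fun L _ ha => (commutant_apply_comm_of_mem_span_range T h𝒟 L.2 hφ ha).symm⟩

/-- `span(T) ≤ ℬ`, as an inclusion of subspaces. [cite: CurtisReiner1962, §59] -/
theorem span_range_le_bicommutant {𝒟 ℬ : Submodule ℚ (V →ₗ[ℚ] V)} {A : Submodule ℚ V}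
    (h𝒟 : ∀ L : V →ₗ[ℚ] V, L ∈ 𝒟 ↔ (∀ a ∈ A, L a ∈ A) ∧ ∀ (i : ι) (a : V), a ∈ A → L (T i a) = T i (L a))
    (hℬ : ∀ ψ : V →ₗ[ℚ] V, ψ ∈ ℬ ↔ (∀ a ∈ A, ψ a ∈ A) ∧
      ∀ (L : ↥𝒟) (a : V), a ∈ A → ψ ((L : V →ₗ[ℚ] V) a) = (L : V →ₗ[ℚ] V) (ψ a))
    (hAst : ∀ (i : ι) (v : V), v ∈ A → T i v ∈ A) : Submodule.span ℚ (Set.range T) ≤ ℬ :=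
  fun _ hφ => mem_bicommutant_of_mem_span_range T h𝒟 hℬ hAst hφ

/-! ### §2 The double commutant theorem -/

/-- **THE DOUBLE COMMUTANT THEOREM.**  `T` closed under composition with identity; `A` finite-dimensional, stable,
IRREDUCIBLE, with commutant `𝒟` (any).  If `ψ : V → V` preserves `A` and COMMUTES WITH EVERY `L ∈ 𝒟` ON `A`, then
**`ψ` agrees on `A` with some `φ ∈ span(T)`**: take a D-basis `b` of `A` (file K1); by density (file C3) some
`φ ∈ span(T)` has `φ b_k = ψ b_k` for all `k`; for `a = Σ_k L_k b_k ∈ A` (`L_k ∈ 𝒟`) both `φ` and `ψ` commute with the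
`L_k` on `A`, so `φ a = Σ_k L_k φ b_k = Σ_k L_k ψ b_k = ψ a`. [cite: Lang2002, XVII §3 Thm. 3.2]
[cite: CurtisReiner1962, §27 (27.8) and §59] -/
theorem exists_mem_span_range_eqOn_of_comm {𝒟 : Submodule ℚ (V →ₗ[ℚ] V)} {A : Submodule ℚ V}
    [FiniteDimensional ℚ A]
    (h𝒟 : ∀ L : V →ₗ[ℚ] V, L ∈ 𝒟 ↔ (∀ a ∈ A, L a ∈ A) ∧ ∀ (i : ι) (a : V), a ∈ A → L (T i a) = T i (L a))
    (h1 : ∃ i₀ : ι, T i₀ = LinearMap.id) (hmul : ∀ i i' : ι, ∃ i'' : ι, T i'' = T i ∘ₗ T i')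
    (hAst : ∀ (i : ι) (v : V), v ∈ A → T i v ∈ A)
    (hAirr : ∀ W : Submodule ℚ V, W ≤ A → W ≠ ⊥ → (∀ (i : ι) (v : V), v ∈ W → T i v ∈ W) → W = A)
    {ψ : V →ₗ[ℚ] V} (hψA : ∀ a ∈ A, ψ a ∈ A)
    (hψc : ∀ L ∈ 𝒟, ∀ a ∈ A, ψ (L a) = L (ψ a)) :
    ∃ φ ∈ Submodule.span ℚ (Set.range T), ∀ a ∈ A, φ a = ψ a := by
  obtain ⟨n, b, hb, hfree, hspan⟩ := exists_free_iSup_eq T h𝒟 hAst hAirr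
  -- density on the D-basis: `(ψ b_k)_k ∈ A^n = 𝔐(b)`
  have hmem : (fun k => ψ (b k)) ∈ Submodule.span ℚ (Set.range fun i : ι => fun k : Fin n => T i (b k)) := by
    rw [span_diag_orbit_eq_pi_of_free T h𝒟 h1 hmul hAst hAirr hb hfree]
    exact fun k _ => hψA _ (hb k)
  obtain ⟨φ, hφ, hφb⟩ := exists_mem_span_range_of_mem_span_diag_orbit T b hmem
  refine ⟨φ, hφ, fun a ha => ?_⟩
  -- write `a = Σ_k L_k b_k` over the commutant
  have ha' : a ∈ ⨆ k, 𝒟.map (LinearMap.applyₗ (b k)) := by rw [hspan]; exact ha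
  obtain ⟨L, hL, rfl⟩ := (mem_iSup_map_applyₗ_iff 𝒟 b a).1 ha'
  rw [map_sum, map_sum]
  refine Finset.sum_congr rfl fun k _ => ?_
  rw [← commutant_apply_comm_of_mem_span_range T h𝒟 (hL k) hφ (hb k), hψc _ (hL k) _ (hb k)]
  exact congrArg (L k) (congrFun hφb k).symm

/-- **THE DOUBLE COMMUTANT THEOREM, `iff` form**: for `ψ` preserving the finite-dimensional stable irreducible `A`,
**`ψ` is the restriction of an element of `span(T)` IFF `ψ` commutes with the commutant on `A`**.
[cite: Lang2002, XVII §3 Thm. 3.2] [cite: CurtisReiner1962, §59] -/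
theorem exists_mem_span_range_eqOn_iff {𝒟 : Submodule ℚ (V →ₗ[ℚ] V)} {A : Submodule ℚ V} [FiniteDimensional ℚ A]
    (h𝒟 : ∀ L : V →ₗ[ℚ] V, L ∈ 𝒟 ↔ (∀ a ∈ A, L a ∈ A) ∧ ∀ (i : ι) (a : V), a ∈ A → L (T i a) = T i (L a))
    (h1 : ∃ i₀ : ι, T i₀ = LinearMap.id) (hmul : ∀ i i' : ι, ∃ i'' : ι, T i'' = T i ∘ₗ T i')
    (hAst : ∀ (i : ι) (v : V), v ∈ A → T i v ∈ A)
    (hAirr : ∀ W : Submodule ℚ V, W ≤ A → W ≠ ⊥ → (∀ (i : ι) (v : V), v ∈ W → T i v ∈ W) → W = A)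
    {ψ : V →ₗ[ℚ] V} (hψA : ∀ a ∈ A, ψ a ∈ A) :
    (∃ φ ∈ Submodule.span ℚ (Set.range T), ∀ a ∈ A, φ a = ψ a) ↔
      ∀ L ∈ 𝒟, ∀ a ∈ A, ψ (L a) = L (ψ a) := by
  refine ⟨?_, exists_mem_span_range_eqOn_of_comm T h𝒟 h1 hmul hAst hAirr hψA⟩
  rintro ⟨φ, hφ, hφψ⟩ L hL a ha
  have hLa : L a ∈ A := ((h𝒟 L).1 hL).1 a ha
  rw [← hφψ _ hLa, ← hφψ _ ha]
  exact (commutant_apply_comm_of_mem_span_range T h𝒟 hL hφ ha).symm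

/-- Elements of the bicommutant are restrictions of `span(T)` (the double commutant theorem in the `ℬ`-currency).
[cite: CurtisReiner1962, §59] [cite: Lang2002, XVII §3 Thm. 3.2] -/
theorem exists_mem_span_range_eqOn_of_mem_bicommutant {𝒟 ℬ : Submodule ℚ (V →ₗ[ℚ] V)} {A : Submodule ℚ V}
    [FiniteDimensional ℚ A]
    (h𝒟 : ∀ L : V →ₗ[ℚ] V, L ∈ 𝒟 ↔ (∀ a ∈ A, L a ∈ A) ∧ ∀ (i : ι) (a : V), a ∈ A → L (T i a) = T i (L a))
    (hℬ : ∀ ψ : V →ₗ[ℚ] V, ψ ∈ ℬ ↔ (∀ a ∈ A, ψ a ∈ A) ∧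
      ∀ (L : ↥𝒟) (a : V), a ∈ A → ψ ((L : V →ₗ[ℚ] V) a) = (L : V →ₗ[ℚ] V) (ψ a))
    (h1 : ∃ i₀ : ι, T i₀ = LinearMap.id) (hmul : ∀ i i' : ι, ∃ i'' : ι, T i'' = T i ∘ₗ T i')
    (hAst : ∀ (i : ι) (v : V), v ∈ A → T i v ∈ A)
    (hAirr : ∀ W : Submodule ℚ V, W ≤ A → W ≠ ⊥ → (∀ (i : ι) (v : V), v ∈ W → T i v ∈ W) → W = A)
    {ψ : V →ₗ[ℚ] V} (hψ : ψ ∈ ℬ) :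
    ∃ φ ∈ Submodule.span ℚ (Set.range T), ∀ a ∈ A, φ a = ψ a := by
  obtain ⟨hψA, hψc⟩ := (hℬ ψ).1 hψ
  exact exists_mem_span_range_eqOn_of_comm T h𝒟 h1 hmul hAst hAirr hψA fun L hL a ha => hψc ⟨L, hL⟩ a ha

/-- **`ℬ|_A = span(T)|_A`**: restricted to the finite-dimensional stable irreducible `A`, the bicommutant and the
span of the operators coincide — `ℬ.map (domRestrict' A) = (span T).map (domRestrict' A)` in `Hom_ℚ(A, V)`.
[cite: CurtisReiner1962, §59] [cite: Lang2002, XVII §3 Thm. 3.2 and Cor. 3.5] -/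
theorem map_domRestrict'_bicommutant_eq {𝒟 ℬ : Submodule ℚ (V →ₗ[ℚ] V)} {A : Submodule ℚ V}
    [FiniteDimensional ℚ A]
    (h𝒟 : ∀ L : V →ₗ[ℚ] V, L ∈ 𝒟 ↔ (∀ a ∈ A, L a ∈ A) ∧ ∀ (i : ι) (a : V), a ∈ A → L (T i a) = T i (L a))
    (hℬ : ∀ ψ : V →ₗ[ℚ] V, ψ ∈ ℬ ↔ (∀ a ∈ A, ψ a ∈ A) ∧
      ∀ (L : ↥𝒟) (a : V), a ∈ A → ψ ((L : V →ₗ[ℚ] V) a) = (L : V →ₗ[ℚ] V) (ψ a))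
    (h1 : ∃ i₀ : ι, T i₀ = LinearMap.id) (hmul : ∀ i i' : ι, ∃ i'' : ι, T i'' = T i ∘ₗ T i')
    (hAst : ∀ (i : ι) (v : V), v ∈ A → T i v ∈ A)
    (hAirr : ∀ W : Submodule ℚ V, W ≤ A → W ≠ ⊥ → (∀ (i : ι) (v : V), v ∈ W → T i v ∈ W) → W = A) :
    ℬ.map (LinearMap.domRestrict' A) = (Submodule.span ℚ (Set.range T)).map (LinearMap.domRestrict' A) := by
  refine le_antisymm ?_ (Submodule.map_mono (span_range_le_bicommutant T h𝒟 hℬ hAst))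
  rintro _ ⟨ψ, hψ, rfl⟩
  obtain ⟨φ, hφ, hφψ⟩ := exists_mem_span_range_eqOn_of_mem_bicommutant T h𝒟 hℬ h1 hmul hAst hAirr hψ
  refine ⟨φ, hφ, LinearMap.ext fun a => ?_⟩
  rw [LinearMap.domRestrict'_apply, LinearMap.domRestrict'_apply]
  exact hφψ a a.2

/-- **`dim ℬ|_A · δ = (dim A)²`** (`0 ≠ a₀ ∈ A` names `δ`; K1's Wedderburn count through `ℬ|_A = span(T)|_A`).
[cite: Lang2002, XVII §3 Cor. 3.5] [cite: CurtisReiner1962, §59] -/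
theorem finrank_map_domRestrict'_bicommutant_mul_eq {𝒟 ℬ : Submodule ℚ (V →ₗ[ℚ] V)} {A : Submodule ℚ V}
    [FiniteDimensional ℚ A]
    (h𝒟 : ∀ L : V →ₗ[ℚ] V, L ∈ 𝒟 ↔ (∀ a ∈ A, L a ∈ A) ∧ ∀ (i : ι) (a : V), a ∈ A → L (T i a) = T i (L a))
    (hℬ : ∀ ψ : V →ₗ[ℚ] V, ψ ∈ ℬ ↔ (∀ a ∈ A, ψ a ∈ A) ∧
      ∀ (L : ↥𝒟) (a : V), a ∈ A → ψ ((L : V →ₗ[ℚ] V) a) = (L : V →ₗ[ℚ] V) (ψ a))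
    (h1 : ∃ i₀ : ι, T i₀ = LinearMap.id) (hmul : ∀ i i' : ι, ∃ i'' : ι, T i'' = T i ∘ₗ T i')
    (hAst : ∀ (i : ι) (v : V), v ∈ A → T i v ∈ A)
    (hAirr : ∀ W : Submodule ℚ V, W ≤ A → W ≠ ⊥ → (∀ (i : ι) (v : V), v ∈ W → T i v ∈ W) → W = A)
    {a₀ : V} (ha₀ : a₀ ∈ A) (h0 : a₀ ≠ 0) :
    Module.finrank ℚ ↥(ℬ.map (LinearMap.domRestrict' A)) * Module.finrank ℚ ↥(𝒟.map (LinearMap.applyₗ a₀)) =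
      Module.finrank ℚ A * Module.finrank ℚ A := by
  rw [map_domRestrict'_bicommutant_eq T h𝒟 hℬ h1 hmul hAst hAirr]
  exact finrank_map_domRestrict'_span_mul_eq T h𝒟 h1 hmul hAst hAirr ha₀ h0

/-- **THE DOUBLE CENTRALIZER COUNT `dim 𝒟|_A · dim ℬ|_A = (dim A)²`** (`A ≠ 0` finite-dimensional stable
irreducible, `T` closed under composition with identity). [cite: Lang2002, XVII §3 Cor. 3.5]
[cite: CurtisReiner1962, §59] -/
theorem finrank_commutant_mul_finrank_bicommutant_eq {𝒟 ℬ : Submodule ℚ (V →ₗ[ℚ] V)} {A : Submodule ℚ V}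
    [FiniteDimensional ℚ A]
    (h𝒟 : ∀ L : V →ₗ[ℚ] V, L ∈ 𝒟 ↔ (∀ a ∈ A, L a ∈ A) ∧ ∀ (i : ι) (a : V), a ∈ A → L (T i a) = T i (L a))
    (hℬ : ∀ ψ : V →ₗ[ℚ] V, ψ ∈ ℬ ↔ (∀ a ∈ A, ψ a ∈ A) ∧
      ∀ (L : ↥𝒟) (a : V), a ∈ A → ψ ((L : V →ₗ[ℚ] V) a) = (L : V →ₗ[ℚ] V) (ψ a))
    (h1 : ∃ i₀ : ι, T i₀ = LinearMap.id) (hmul : ∀ i i' : ι, ∃ i'' : ι, T i'' = T i ∘ₗ T i')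
    (hAst : ∀ (i : ι) (v : V), v ∈ A → T i v ∈ A)
    (hAirr : ∀ W : Submodule ℚ V, W ≤ A → W ≠ ⊥ → (∀ (i : ι) (v : V), v ∈ W → T i v ∈ W) → W = A)
    (hA : A ≠ ⊥) :
    Module.finrank ℚ ↥(𝒟.map (LinearMap.domRestrict' A)) * Module.finrank ℚ ↥(ℬ.map (LinearMap.domRestrict' A)) =
      Module.finrank ℚ A * Module.finrank ℚ A := by
  rw [map_domRestrict'_bicommutant_eq T h𝒟 hℬ h1 hmul hAst hAirr]
  exact finrank_commutant_mul_finrank_span_restrict_eq T h𝒟 h1 hmul hAst hAirr hA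

/-! ### §3 Burnside; the triple commutant; `span(T)|_A` depends only on `𝒟` -/

/-- **BURNSIDE'S THEOREM**: if the commutant of the finite-dimensional stable irreducible `A` is SCALAR, then
**every** `ψ : V → V` with `ψ(A) ⊆ A` agrees on `A` with an element of `span(T)` — the operators restrict to all of
`End_ℚ(A)`. [cite: Lang2002, XVII §3 Cor. 3.3] [cite: CurtisReiner1962, §27 (27.4)] [cite: Serre1977, §6.2] -/
theorem exists_mem_span_range_eqOn_of_scalar {𝒟 : Submodule ℚ (V →ₗ[ℚ] V)} {A : Submodule ℚ V}
    [FiniteDimensional ℚ A]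
    (h𝒟 : ∀ L : V →ₗ[ℚ] V, L ∈ 𝒟 ↔ (∀ a ∈ A, L a ∈ A) ∧ ∀ (i : ι) (a : V), a ∈ A → L (T i a) = T i (L a))
    (hsc : ∀ L : V →ₗ[ℚ] V, (∀ a ∈ A, L a ∈ A) → (∀ (i : ι) (a : V), a ∈ A → L (T i a) = T i (L a)) →
      ∃ c : ℚ, ∀ a ∈ A, L a = c • a)
    (h1 : ∃ i₀ : ι, T i₀ = LinearMap.id) (hmul : ∀ i i' : ι, ∃ i'' : ι, T i'' = T i ∘ₗ T i')
    (hAst : ∀ (i : ι) (v : V), v ∈ A → T i v ∈ A)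
    (hAirr : ∀ W : Submodule ℚ V, W ≤ A → W ≠ ⊥ → (∀ (i : ι) (v : V), v ∈ W → T i v ∈ W) → W = A)
    {ψ : V →ₗ[ℚ] V} (hψA : ∀ a ∈ A, ψ a ∈ A) :
    ∃ φ ∈ Submodule.span ℚ (Set.range T), ∀ a ∈ A, φ a = ψ a := by
  refine exists_mem_span_range_eqOn_of_comm T h𝒟 h1 hmul hAst hAirr hψA fun L hL a ha => ?_
  obtain ⟨c, hc⟩ := hsc L ((h𝒟 L).1 hL).1 ((h𝒟 L).1 hL).2
  rw [hc a ha, map_smul, hc _ (hψA a ha)]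

/-- Burnside, restricted form: scalar commutant ⟹ **`span(T)|_A` is ALL of `{f ∈ Hom_ℚ(A,V) : f(A) ⊆ A}`**, i.e.
every linear `f : A → V` with values in `A` is the restriction of an element of `span(T)`.
[cite: Lang2002, XVII §3 Cor. 3.3] [cite: CurtisReiner1962, §27 (27.4)] -/
theorem mem_map_domRestrict'_span_of_scalar {𝒟 : Submodule ℚ (V →ₗ[ℚ] V)} {A : Submodule ℚ V}
    [FiniteDimensional ℚ A]
    (h𝒟 : ∀ L : V →ₗ[ℚ] V, L ∈ 𝒟 ↔ (∀ a ∈ A, L a ∈ A) ∧ ∀ (i : ι) (a : V), a ∈ A → L (T i a) = T i (L a))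
    (hsc : ∀ L : V →ₗ[ℚ] V, (∀ a ∈ A, L a ∈ A) → (∀ (i : ι) (a : V), a ∈ A → L (T i a) = T i (L a)) →
      ∃ c : ℚ, ∀ a ∈ A, L a = c • a)
    (h1 : ∃ i₀ : ι, T i₀ = LinearMap.id) (hmul : ∀ i i' : ι, ∃ i'' : ι, T i'' = T i ∘ₗ T i')
    (hAst : ∀ (i : ι) (v : V), v ∈ A → T i v ∈ A)
    (hAirr : ∀ W : Submodule ℚ V, W ≤ A → W ≠ ⊥ → (∀ (i : ι) (v : V), v ∈ W → T i v ∈ W) → W = A)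
    {f : A →ₗ[ℚ] V} (hf : ∀ a : A, f a ∈ A) :
    f ∈ (Submodule.span ℚ (Set.range T)).map (LinearMap.domRestrict' A) := by
  -- extend `f` to `V` through a linear retraction onto `A`
  obtain ⟨π, hπ⟩ := A.subtype.exists_leftInverse_of_injective A.ker_subtype
  have hπa : ∀ a : A, π (a : V) = a := fun a => by
    have h := LinearMap.congr_fun hπ a
    rw [LinearMap.comp_apply, LinearMap.id_apply] at h
    exact h
  obtain ⟨φ, hφ, hφψ⟩ := exists_mem_span_range_eqOn_of_scalar T h𝒟 hsc h1 hmul hAst hAirr (ψ := f ∘ₗ π)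
    (fun a ha => by rw [LinearMap.comp_apply, show π a = ⟨a, ha⟩ from hπa ⟨a, ha⟩]; exact hf _)
  refine ⟨φ, hφ, LinearMap.ext fun a => ?_⟩
  rw [LinearMap.domRestrict'_apply, hφψ a a.2, LinearMap.comp_apply, hπa]

/-- **`δ = 1` ⟹ THE COMMUTANT IS SCALAR**: if the D-line of some `0 ≠ a₀ ∈ A` is a line, every `L ∈ 𝒟` acts on
`A` as a rational scalar (`L a₀ = c a₀`, and `L − c` lies in `𝒟` and kills `a₀`, so vanishes on `A` by Schur).
The converse is file C2's `finrank_map_applyₗ_eq_one_of_scalar`. [cite: Lang2002, XVII §1 Prop. 1.1]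
[cite: CurtisReiner1962, §27 (27.3)] -/
theorem exists_eq_smul_of_finrank_map_applyₗ_eq_one {𝒟 : Submodule ℚ (V →ₗ[ℚ] V)} {A : Submodule ℚ V}
    [FiniteDimensional ℚ A]
    (h𝒟 : ∀ L : V →ₗ[ℚ] V, L ∈ 𝒟 ↔ (∀ a ∈ A, L a ∈ A) ∧ ∀ (i : ι) (a : V), a ∈ A → L (T i a) = T i (L a))
    (hAst : ∀ (i : ι) (v : V), v ∈ A → T i v ∈ A)
    (hAirr : ∀ W : Submodule ℚ V, W ≤ A → W ≠ ⊥ → (∀ (i : ι) (v : V), v ∈ W → T i v ∈ W) → W = A)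
    {a₀ : V} (ha₀ : a₀ ∈ A) (h0 : a₀ ≠ 0) (hδ : Module.finrank ℚ ↥(𝒟.map (LinearMap.applyₗ a₀)) = 1)
    {L : V →ₗ[ℚ] V} (hL : L ∈ 𝒟) : ∃ c : ℚ, ∀ a ∈ A, L a = c • a := by
  -- the D-line of `a₀` is the line `ℚ a₀`
  haveI : FiniteDimensional ℚ ↥(𝒟.map (LinearMap.applyₗ a₀)) :=
    Submodule.finiteDimensional_of_le (map_applyₗ_le T h𝒟 ha₀)
  have hline : (ℚ ∙ a₀) = 𝒟.map (LinearMap.applyₗ a₀) :=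
    Submodule.eq_of_le_of_finrank_eq
      ((Submodule.span_singleton_le_iff_mem a₀ _).2 (self_mem_map_applyₗ T h𝒟 a₀))
      (by rw [finrank_span_singleton h0, hδ])
  have hmem : L a₀ ∈ ℚ ∙ a₀ := by
    rw [hline]
    exact ⟨L, hL, rfl⟩
  obtain ⟨c, hc⟩ := Submodule.mem_span_singleton.1 hmem
  refine ⟨c, fun a ha => ?_⟩
  -- `L - c·id ∈ 𝒟` kills `a₀`, hence vanishes on `A`
  have hL' : L - c • LinearMap.id ∈ 𝒟 :=
    Submodule.sub_mem _ hL (Submodule.smul_mem _ c (commutant_id_mem T h𝒟))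
  rcases commutant_zero_or_injOn T h𝒟 hAst hAirr hL' with hzero | hinj
  · have h := hzero a ha
    rw [LinearMap.sub_apply, LinearMap.smul_apply, LinearMap.id_apply, sub_eq_zero] at h
    exact h
  · exfalso
    refine h0 (hinj a₀ ha₀ ?_)
    rw [LinearMap.sub_apply, LinearMap.smul_apply, LinearMap.id_apply, ← hc, sub_self]

/-- `span(T)|_A` is FINITE-DIMENSIONAL (it consists of maps `A → V` with values in the finite-dimensional `A`).
[folklore] -/
theorem finite_map_domRestrict'_span {A : Submodule ℚ V} [FiniteDimensional ℚ A]
    (hAst : ∀ (i : ι) (v : V), v ∈ A → T i v ∈ A) :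
    Module.Finite ℚ ↥((Submodule.span ℚ (Set.range T)).map (LinearMap.domRestrict' A)) := by
  -- post-composition with the inclusion `A ↪ V`, a linear map `End(A) → Hom(A, V)`
  let post : (A →ₗ[ℚ] A) →ₗ[ℚ] (A →ₗ[ℚ] V) :=
    { toFun := fun g => A.subtype ∘ₗ g
      map_add' := fun g g' => LinearMap.ext fun a => by simp
      map_smul' := fun t g => LinearMap.ext fun a => by simp }
  haveI : Module.Finite ℚ ↥((⊤ : Submodule ℚ (A →ₗ[ℚ] A)).map post) := Module.Finite.map _ _
  refine Submodule.finiteDimensional_of_le (fun f hf => ?_ :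
    (Submodule.span ℚ (Set.range T)).map (LinearMap.domRestrict' A) ≤ (⊤ : Submodule ℚ (A →ₗ[ℚ] A)).map post)
  obtain ⟨φ, hφ, rfl⟩ := hf
  refine ⟨φ.restrict fun a ha => apply_mem_of_mem_span_range T hAst hφ ha, trivial, LinearMap.ext fun a => ?_⟩
  rfl

/-- **BURNSIDE, `iff` FORM**: for `A ≠ 0` finite-dimensional stable irreducible and `T` closed under composition with
identity, **every linear `f : A → V` with values in `A` is the restriction of an element of `span(T)` IFF `δ = 1`**
(scalar commutant).  (⟸: Burnside; ⟹: `span(T)|_A` then has dimension `(dim A)²`, and K1's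
`finrank_map_domRestrict'_span_eq_sq_iff`.) [cite: Lang2002, XVII §3 Cor. 3.3] [cite: CurtisReiner1962, §27 (27.4)] -/
theorem forall_mem_map_domRestrict'_span_iff_finrank_eq_one {𝒟 : Submodule ℚ (V →ₗ[ℚ] V)} {A : Submodule ℚ V}
    [FiniteDimensional ℚ A]
    (h𝒟 : ∀ L : V →ₗ[ℚ] V, L ∈ 𝒟 ↔ (∀ a ∈ A, L a ∈ A) ∧ ∀ (i : ι) (a : V), a ∈ A → L (T i a) = T i (L a))
    (h1 : ∃ i₀ : ι, T i₀ = LinearMap.id) (hmul : ∀ i i' : ι, ∃ i'' : ι, T i'' = T i ∘ₗ T i')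
    (hAst : ∀ (i : ι) (v : V), v ∈ A → T i v ∈ A)
    (hAirr : ∀ W : Submodule ℚ V, W ≤ A → W ≠ ⊥ → (∀ (i : ι) (v : V), v ∈ W → T i v ∈ W) → W = A)
    {a₀ : V} (ha₀ : a₀ ∈ A) (h0 : a₀ ≠ 0) :
    (∀ f : A →ₗ[ℚ] V, (∀ a : A, f a ∈ A) → f ∈ (Submodule.span ℚ (Set.range T)).map (LinearMap.domRestrict' A)) ↔
      Module.finrank ℚ ↥(𝒟.map (LinearMap.applyₗ a₀)) = 1 := by
  constructor
  · intro H
    -- `span(T)|_A` contains the image of `End(A)`, of dimension `(dim A)²`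
    let post : (A →ₗ[ℚ] A) →ₗ[ℚ] (A →ₗ[ℚ] V) :=
      { toFun := fun g => A.subtype ∘ₗ g
        map_add' := fun g g' => LinearMap.ext fun a => by simp
        map_smul' := fun t g => LinearMap.ext fun a => by simp }
    have hinj : Function.Injective post := fun g g' hgg' =>
      LinearMap.ext fun a => A.injective_subtype (LinearMap.congr_fun hgg' a)
    have hle : LinearMap.range post ≤ (Submodule.span ℚ (Set.range T)).map (LinearMap.domRestrict' A) := by
      rintro _ ⟨g, rfl⟩
      exact H _ fun a => (g a).2
    haveI := finite_map_domRestrict'_span T (A := A) hAst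
    have hdim := Submodule.finrank_mono hle
    rw [LinearMap.finrank_range_of_inj hinj, Module.finrank_linearMap] at hdim
    exact (finrank_map_domRestrict'_span_eq_sq_iff T h𝒟 h1 hmul hAst hAirr ha₀ h0).1
      (le_antisymm (finrank_map_domRestrict'_span_le_sq T h𝒟 h1 hmul hAst hAirr) hdim)
  · intro hδ f hf
    exact mem_map_domRestrict'_span_of_scalar T h𝒟
      (fun L hLA hLc => exists_eq_smul_of_finrank_map_applyₗ_eq_one T h𝒟 hAst hAirr ha₀ h0 hδ ((h𝒟 L).2 ⟨hLA, hLc⟩))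
      h1 hmul hAst hAirr hf

/-- **THE TRIPLE COMMUTANT IS THE COMMUTANT**: for `L` preserving `A`, **`L ∈ 𝒟` IFF `L` commutes with the
bicommutant on `A`** (`T_i ∈ span(T) ≤ ℬ`). [cite: CurtisReiner1962, §59] -/
theorem mem_commutant_iff_forall_bicommutant {𝒟 ℬ : Submodule ℚ (V →ₗ[ℚ] V)} {A : Submodule ℚ V}
    (h𝒟 : ∀ L : V →ₗ[ℚ] V, L ∈ 𝒟 ↔ (∀ a ∈ A, L a ∈ A) ∧ ∀ (i : ι) (a : V), a ∈ A → L (T i a) = T i (L a))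
    (hℬ : ∀ ψ : V →ₗ[ℚ] V, ψ ∈ ℬ ↔ (∀ a ∈ A, ψ a ∈ A) ∧
      ∀ (L : ↥𝒟) (a : V), a ∈ A → ψ ((L : V →ₗ[ℚ] V) a) = (L : V →ₗ[ℚ] V) (ψ a))
    (hAst : ∀ (i : ι) (v : V), v ∈ A → T i v ∈ A) {L : V →ₗ[ℚ] V} (hLA : ∀ a ∈ A, L a ∈ A) :
    L ∈ 𝒟 ↔ ∀ ψ ∈ ℬ, ∀ a ∈ A, L (ψ a) = ψ (L a) := by
  constructor
  · intro hL ψ hψ a ha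
    exact (((hℬ ψ).1 hψ).2 ⟨L, hL⟩ a ha).symm
  · intro h
    refine (h𝒟 L).2 ⟨hLA, fun i a ha => ?_⟩
    exact h (T i) (mem_bicommutant_of_mem_span_range T h𝒟 hℬ hAst (Submodule.subset_span ⟨i, rfl⟩)) a ha

/-- **`span(T)|_A` DEPENDS ON THE OPERATORS ONLY THROUGH THEIR COMMUTANT**: two families `T`, `T′` (each closed
under composition with identity, `A` finite-dimensional stable irreducible for each) with THE SAME commutant `𝒟`
on `A` have `(span T).map (domRestrict' A) = (span T′).map (domRestrict' A)` — both are `ℬ|_A`.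
[cite: CurtisReiner1962, §59] [cite: Lang2002, XVII §3 Thm. 3.2] -/
theorem map_domRestrict'_span_eq_of_commutant_eq {ι' : Type w'} (T' : ι' → V →ₗ[ℚ] V)
    {𝒟 : Submodule ℚ (V →ₗ[ℚ] V)} {A : Submodule ℚ V} [FiniteDimensional ℚ A]
    (h𝒟 : ∀ L : V →ₗ[ℚ] V, L ∈ 𝒟 ↔ (∀ a ∈ A, L a ∈ A) ∧ ∀ (i : ι) (a : V), a ∈ A → L (T i a) = T i (L a))
    (h𝒟' : ∀ L : V →ₗ[ℚ] V, L ∈ 𝒟 ↔ (∀ a ∈ A, L a ∈ A) ∧ ∀ (i : ι') (a : V), a ∈ A → L (T' i a) = T' i (L a))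
    (h1 : ∃ i₀ : ι, T i₀ = LinearMap.id) (hmul : ∀ i i' : ι, ∃ i'' : ι, T i'' = T i ∘ₗ T i')
    (hAst : ∀ (i : ι) (v : V), v ∈ A → T i v ∈ A)
    (hAirr : ∀ W : Submodule ℚ V, W ≤ A → W ≠ ⊥ → (∀ (i : ι) (v : V), v ∈ W → T i v ∈ W) → W = A)
    (h1' : ∃ i₀ : ι', T' i₀ = LinearMap.id) (hmul' : ∀ i i' : ι', ∃ i'' : ι', T' i'' = T' i ∘ₗ T' i')
    (hAst' : ∀ (i : ι') (v : V), v ∈ A → T' i v ∈ A)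
    (hAirr' : ∀ W : Submodule ℚ V, W ≤ A → W ≠ ⊥ → (∀ (i : ι') (v : V), v ∈ W → T' i v ∈ W) → W = A) :
    (Submodule.span ℚ (Set.range T)).map (LinearMap.domRestrict' A) =
      (Submodule.span ℚ (Set.range T')).map (LinearMap.domRestrict' A) := by
  obtain ⟨ℬ, hℬ⟩ := exists_bicommutant 𝒟 A
  rw [← map_domRestrict'_bicommutant_eq T h𝒟 hℬ h1 hmul hAst hAirr,
    ← map_domRestrict'_bicommutant_eq T' h𝒟' hℬ h1' hmul' hAst' hAirr']

/-- In particular two such families restrict to subspaces of `Hom_ℚ(A, V)` of THE SAME DIMENSION `(dim A)²/δ`.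
[cite: Lang2002, XVII §3 Cor. 3.5] -/
theorem finrank_map_domRestrict'_span_eq_of_commutant_eq {ι' : Type w'} (T' : ι' → V →ₗ[ℚ] V)
    {𝒟 : Submodule ℚ (V →ₗ[ℚ] V)} {A : Submodule ℚ V} [FiniteDimensional ℚ A]
    (h𝒟 : ∀ L : V →ₗ[ℚ] V, L ∈ 𝒟 ↔ (∀ a ∈ A, L a ∈ A) ∧ ∀ (i : ι) (a : V), a ∈ A → L (T i a) = T i (L a))
    (h𝒟' : ∀ L : V →ₗ[ℚ] V, L ∈ 𝒟 ↔ (∀ a ∈ A, L a ∈ A) ∧ ∀ (i : ι') (a : V), a ∈ A → L (T' i a) = T' i (L a))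
    (h1 : ∃ i₀ : ι, T i₀ = LinearMap.id) (hmul : ∀ i i' : ι, ∃ i'' : ι, T i'' = T i ∘ₗ T i')
    (hAst : ∀ (i : ι) (v : V), v ∈ A → T i v ∈ A)
    (hAirr : ∀ W : Submodule ℚ V, W ≤ A → W ≠ ⊥ → (∀ (i : ι) (v : V), v ∈ W → T i v ∈ W) → W = A)
    (h1' : ∃ i₀ : ι', T' i₀ = LinearMap.id) (hmul' : ∀ i i' : ι', ∃ i'' : ι', T' i'' = T' i ∘ₗ T' i')
    (hAst' : ∀ (i : ι') (v : V), v ∈ A → T' i v ∈ A)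
    (hAirr' : ∀ W : Submodule ℚ V, W ≤ A → W ≠ ⊥ → (∀ (i : ι') (v : V), v ∈ W → T' i v ∈ W) → W = A) :
    Module.finrank ℚ ↥((Submodule.span ℚ (Set.range T)).map (LinearMap.domRestrict' A)) =
      Module.finrank ℚ ↥((Submodule.span ℚ (Set.range T')).map (LinearMap.domRestrict' A)) := by
  rw [map_domRestrict'_span_eq_of_commutant_eq T T' h𝒟 h𝒟' h1 hmul hAst hAirr h1' hmul' hAst' hAirr']

end Summit.HodgeConjecture.CorCM.IrrOdd

end
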